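import Literature.MathematicalPhysics.QuantumFieldTheory.Balaban1983to89.B10
import HarnessLib

/-!
# Route `SmallFieldWidening`, crux r3 `LargeFieldMassRefinementTail` (stmt-QuantumFields-22884), line `birth`:
# stub `stub_seriesTail` — the refined large-field sums are dominated by the tail of ONE convergent series

Lead prover `ym-line-sfw-p2` (2026-08-27).  The registered stub `stub_seriesTail` of the line's skeleton
(`Summits/QuantumFields/YangMills/Cruxes/LargeFieldMassRefinementTail/Lines/birth.lean`, v2): for a block size `L > 1`,
a volume exponent `m`, a polynomial degree `A`, a Bałaban profile `p(g) = b₀(1 + log g⁻¹)^{p₀}` (`b₀ > 0`, `p₀ ≥ 1`,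
tree `B10.pFun`), constants `c > 0`, `C ≥ 0` and a coupling `γ > 0`, the finite sums

  `S(n, K) = Σ_{i ≤ K} C · L^{3(m+n+i)} · (γL^{-n}L^{-i})^{-A} · exp(−c · p(√(γL^{-n}L^{-i}))²)`

(the per-run large-field mass bound of run `K` of the `n`-times refined family at coupling `γL^{-n}`: volume `L^{3(m+n+i)}`,
inverse coupling `β_i^A`, Gaussian large-field factor) satisfy `S(n, K) ≤ δ n` for ALL `K`, with `δ n → 0`.

Proof (elementary real analysis, the technique of the tree's `T3BareTailProfile.bareTailAt` /
`T3AveragedTailProfile.perHeight_bound`): the summand depends on `k = n + i` only, `S(n, K) = Σ_{i ≤ K} a(n+i)` with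
`a(k) = C L^{3(m+k)} (γL^{-k})^{-A} exp(−c p(g_k)²)`, `g_k = √(γL^{-k})`; for `k log L ≥ 2 max(log γ, 0)` one has
`1 + log g_k⁻¹ ≥ max(1, k log L / 4)`, hence `p(g_k) ≥ b₀ k log L / 4` (`p₀ ≥ 1`) and
`a(k) ≤ C L^{3m} γ^{-A} · L^{(3+A)k} e^{−(c b₀² log²L/16) k²} ≤ M · 2^{-k}` (completing the square), so `a` is summable and
`δ n := Σ_{k ≥ n} a(k)` (the `n`-tail) works (`tendsto_sum_nat_add`).  Nothing here is specific to gauge theories; no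
summit statement is touched (the file supports the crux item; the YM mass gap is not proved by this line).
-/

noncomputable section

open Filter Topology
open Literature.MathematicalPhysics.QuantumFieldTheory.Balaban1983to89

namespace Summit.QuantumFields.YangMills.Theorems.LargeFieldMassRefinementTail

/-- Completing the square: `b t − a t² ≤ b²/(4a)` for `a > 0`. [folklore] -/
theorem quadratic_le_sq_div {a : ℝ} (ha : 0 < a) (b t : ℝ) : b * t - a * t ^ 2 ≤ b ^ 2 / (4 * a) := by
  rw [le_div_iff₀ (by positivity)]
  nlinarith [sq_nonneg (2 * a * t - b)]
set_option maxHeartbeats 400000 in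
/-- **The `k`-th term is eventually geometric**: for `k log L ≥ 2 max(log γ, 0)`,
`C L^{3(m+k)} (γL^{-k})^{-A} exp(−c p(√(γL^{-k}))²) ≤ M · (1/2)^k` with the explicit constant
`M = C L^{3m} γ^{-A} exp(b²/(4α))`, `α = c b₀² log²L / 16`, `b = (3 + A) log L + log 2` (`p(g_k) ≥ b₀ k log L / 4`,
Gaussian beats exponential). [folklore] -/
theorem term_le_geometric {L : ℕ} (hL : 1 < L) (m A : ℕ) {b₀ p₀ c C γ : ℝ} (hb₀ : 0 < b₀) (hp₀ : 1 ≤ p₀)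
    (hc : 0 < c) (hC : 0 ≤ C) (hγ : 0 < γ) {k : ℕ} (hk : 2 * max (Real.log γ) 0 ≤ (k : ℝ) * Real.log L) :
    C * (L : ℝ) ^ (3 * (m + k)) * ((γ * ((L : ℝ)⁻¹) ^ k)⁻¹) ^ A *
        Real.exp (-(c * B10.pFun b₀ p₀ (Real.sqrt (γ * ((L : ℝ)⁻¹) ^ k)) ^ 2)) ≤
      (C * (L : ℝ) ^ (3 * m) * γ⁻¹ ^ A *
          Real.exp ((((3 : ℝ) + A) * Real.log L + Real.log 2) ^ 2 / (4 * (c * b₀ ^ 2 * Real.log L ^ 2 / 16)))) *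
        ((1 : ℝ) / 2) ^ k := by
  have hL1 : (1 : ℝ) < L := by exact_mod_cast hL
  have hL0 : (0 : ℝ) < L := one_pos.trans hL1
  set ℓ : ℝ := Real.log L with hℓ
  have hℓ0 : 0 < ℓ := Real.log_pos hL1
  set α : ℝ := c * b₀ ^ 2 * ℓ ^ 2 / 16 with hα
  have hα0 : 0 < α := by positivity
  set b : ℝ := (3 + A) * ℓ + Real.log 2 with hb
  -- the coupling at distance `k` from the unit scale
  set x : ℝ := γ * ((L : ℝ)⁻¹) ^ k with hx
  have hLK0 : (0 : ℝ) < (L : ℝ) ^ k := pow_pos hL0 k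
  have hinvK : ((L : ℝ)⁻¹) ^ k = ((L : ℝ) ^ k)⁻¹ := by rw [inv_pow]
  have hx0 : 0 < x := by rw [hx, hinvK]; positivity
  have hxinv : x⁻¹ = γ⁻¹ * (L : ℝ) ^ k := by rw [hx, hinvK, mul_inv, inv_inv]
  set g : ℝ := Real.sqrt x with hg
  have hg0 : 0 < g := Real.sqrt_pos.mpr hx0
  have hlogg : Real.log g⁻¹ = (k * ℓ - Real.log γ) / 2 := by
    rw [Real.log_inv, hg, Real.log_sqrt hx0.le, hx, Real.log_mul hγ.ne' (pow_ne_zero _ (inv_ne_zero hL0.ne')),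
      Real.log_pow, Real.log_inv]
    ring
  set u : ℝ := 1 + Real.log g⁻¹ with hu
  have hmax0 : 0 ≤ max (Real.log γ) 0 := le_max_right _ _
  have hmaxγ : Real.log γ ≤ max (Real.log γ) 0 := le_max_left _ _
  have hu1 : 1 ≤ u := by
    rw [hu, hlogg]
    have : Real.log γ ≤ (k : ℝ) * ℓ := by linarith
    linarith
  have huK : (k : ℝ) * ℓ / 4 ≤ u := by
    rw [hu, hlogg]; linarith
  -- `p(g_k) ≥ b₀ k log L / 4 ≥ 0`
  have hpF : B10.pFun b₀ p₀ g = b₀ * u ^ p₀ := rfl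
  have hup : u ≤ u ^ p₀ := Real.self_le_rpow_of_one_le hu1 hp₀
  have hpF_ge : b₀ * ((k : ℝ) * ℓ / 4) ≤ B10.pFun b₀ p₀ g := by
    rw [hpF]
    calc b₀ * ((k : ℝ) * ℓ / 4) ≤ b₀ * u := by gcongr
      _ ≤ b₀ * u ^ p₀ := by gcongr
  -- the Gaussian factor
  have hexp : Real.exp (-(c * B10.pFun b₀ p₀ g ^ 2)) ≤ Real.exp (-(α * (k : ℝ) ^ 2)) := by
    refine Real.exp_le_exp.mpr ?_
    have hsq : (b₀ * ((k : ℝ) * ℓ / 4)) ^ 2 ≤ B10.pFun b₀ p₀ g ^ 2 :=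
      pow_le_pow_left₀ (by positivity) hpF_ge 2
    have : α * (k : ℝ) ^ 2 = c * (b₀ * ((k : ℝ) * ℓ / 4)) ^ 2 := by rw [hα]; ring
    rw [this]
    nlinarith [mul_le_mul_of_nonneg_left hsq hc.le]
  -- the polynomial factors: `β_k^A = γ^{-A} (L^k)^A`, `L^{3(m+k)} = L^{3m} (L^k)^3`
  have hβA : x⁻¹ ^ A = γ⁻¹ ^ A * ((L : ℝ) ^ k) ^ A := by rw [hxinv, mul_pow]
  have hvol : (L : ℝ) ^ (3 * (m + k)) = (L : ℝ) ^ (3 * m) * ((L : ℝ) ^ k) ^ 3 := by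
    rw [mul_add, pow_add, pow_mul' (L : ℝ) 3 k]
  -- `L^{(3+A)k} e^{−αk²} ≤ e^{b²/4α} 2^{−k}`
  have hLpow : ((L : ℝ) ^ k) ^ 3 * ((L : ℝ) ^ k) ^ A = Real.exp ((3 + A) * ((k : ℝ) * ℓ)) := by
    rw [← pow_add, ← pow_mul, hℓ, show ((3 : ℝ) + A) * ((k : ℝ) * Real.log L) = ((k * (3 + A) : ℕ) : ℝ) * Real.log L by
      push_cast; ring, Real.exp_nat_mul, Real.exp_log hL0]
  have hhalf : ((1 : ℝ) / 2) ^ k = Real.exp (-((k : ℝ) * Real.log 2)) := by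
    rw [Real.exp_neg, Real.exp_nat_mul, Real.exp_log two_pos, one_div, inv_pow]
  have hgauss : ((L : ℝ) ^ k) ^ 3 * ((L : ℝ) ^ k) ^ A * Real.exp (-(α * (k : ℝ) ^ 2)) ≤
      Real.exp (b ^ 2 / (4 * α)) * ((1 : ℝ) / 2) ^ k := by
    rw [hLpow, hhalf, ← Real.exp_add, ← Real.exp_add]
    refine Real.exp_le_exp.mpr ?_
    have hq := quadratic_le_sq_div hα0 b (k : ℝ)
    rw [hb] at hq ⊢
    nlinarith
  -- assemble
  rw [hvol, hβA]
  calc C * ((L : ℝ) ^ (3 * m) * ((L : ℝ) ^ k) ^ 3) * (γ⁻¹ ^ A * ((L : ℝ) ^ k) ^ A) *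
        Real.exp (-(c * B10.pFun b₀ p₀ g ^ 2))
      ≤ C * ((L : ℝ) ^ (3 * m) * ((L : ℝ) ^ k) ^ 3) * (γ⁻¹ ^ A * ((L : ℝ) ^ k) ^ A) *
          Real.exp (-(α * (k : ℝ) ^ 2)) := by gcongr
    _ = (C * (L : ℝ) ^ (3 * m) * γ⁻¹ ^ A) *
          (((L : ℝ) ^ k) ^ 3 * ((L : ℝ) ^ k) ^ A * Real.exp (-(α * (k : ℝ) ^ 2))) := by ring
    _ ≤ (C * (L : ℝ) ^ (3 * m) * γ⁻¹ ^ A) * (Real.exp (b ^ 2 / (4 * α)) * ((1 : ℝ) / 2) ^ k) := by gcongr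
    _ = (C * (L : ℝ) ^ (3 * m) * γ⁻¹ ^ A * Real.exp (b ^ 2 / (4 * α))) * ((1 : ℝ) / 2) ^ k := by ring

/-- **The series `Σ_k C L^{3(m+k)} (γL^{-k})^{-A} exp(−c p(g_k)²)` converges** (`L > 1`, `b₀ > 0`, `p₀ ≥ 1`, `c > 0`,
`C ≥ 0`, `γ > 0`): eventual domination by a geometric series (`term_le_geometric`). [folklore] -/
theorem summable_term {L : ℕ} (hL : 1 < L) (m A : ℕ) {b₀ p₀ c C γ : ℝ} (hb₀ : 0 < b₀) (hp₀ : 1 ≤ p₀)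
    (hc : 0 < c) (hC : 0 ≤ C) (hγ : 0 < γ) :
    Summable fun k : ℕ => C * (L : ℝ) ^ (3 * (m + k)) * ((γ * ((L : ℝ)⁻¹) ^ k)⁻¹) ^ A *
        Real.exp (-(c * B10.pFun b₀ p₀ (Real.sqrt (γ * ((L : ℝ)⁻¹) ^ k)) ^ 2)) := by
  have hL1 : (1 : ℝ) < L := by exact_mod_cast hL
  have hL0 : (0 : ℝ) < L := one_pos.trans hL1
  have hℓ0 : 0 < Real.log L := Real.log_pos hL1
  have hbound : ∀ᶠ k : ℕ in atTop,
      ‖C * (L : ℝ) ^ (3 * (m + k)) * ((γ * ((L : ℝ)⁻¹) ^ k)⁻¹) ^ A *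
          Real.exp (-(c * B10.pFun b₀ p₀ (Real.sqrt (γ * ((L : ℝ)⁻¹) ^ k)) ^ 2))‖ ≤
        (C * (L : ℝ) ^ (3 * m) * γ⁻¹ ^ A *
            Real.exp ((((3 : ℝ) + A) * Real.log L + Real.log 2) ^ 2 / (4 * (c * b₀ ^ 2 * Real.log L ^ 2 / 16)))) *
          ((1 : ℝ) / 2) ^ k := by
    filter_upwards [((tendsto_natCast_atTop_atTop (R := ℝ)).atTop_mul_const hℓ0).eventually_ge_atTop
      (2 * max (Real.log γ) 0)] with k hk
    rw [Real.norm_of_nonneg (by positivity)]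
    exact term_le_geometric hL m A hb₀ hp₀ hc hC hγ hk
  exact Summable.of_norm_bounded_eventually_nat
    ((summable_geometric_of_lt_one (by norm_num : (0 : ℝ) ≤ 1 / 2) (by norm_num)).mul_left _) hbound

/-- **Stub `stub_seriesTail` of line `birth`** (crux r3 `LargeFieldMassRefinementTail`, stmt-QuantumFields-22884): for the
refined data `(m + n, γL^{-n})` the finite large-field sums over the heights `i ≤ K` are bounded, uniformly in `K`, by the
`n`-tail `δ n = Σ_{k ≥ n} a(k)` of one convergent series, and `δ n → 0`. [folklore] -/
theorem stub_seriesTail :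
    ∀ (L m A : ℕ) (b₀ p₀ c C γ : ℝ), 1 < L → 0 < b₀ → 1 ≤ p₀ → 0 < c → 0 ≤ C → 0 < γ →
      ∃ δ : ℕ → ℝ, Tendsto δ atTop (𝓝 0) ∧ ∀ n K : ℕ,
        ∑ i ∈ Finset.range (K + 1), C * (L : ℝ) ^ (3 * (m + n + i)) * ((γ * ((L : ℝ)⁻¹) ^ n * ((L : ℝ)⁻¹) ^ i)⁻¹) ^ A *
            Real.exp (-(c * B10.pFun b₀ p₀ (Real.sqrt (γ * ((L : ℝ)⁻¹) ^ n * ((L : ℝ)⁻¹) ^ i)) ^ 2)) ≤ δ n := by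
  intro L m A b₀ p₀ c C γ hL hb₀ hp₀ hc hC hγ
  have hL0 : (0 : ℝ) < L := by exact_mod_cast (zero_lt_one.trans hL)
  have hsum := summable_term hL m A hb₀ hp₀ hc hC hγ
  -- name the term `a(k)` at distance `k` from the unit scale of the ORIGINAL family
  obtain ⟨a, ha⟩ : ∃ a : ℕ → ℝ, a = fun k : ℕ => C * (L : ℝ) ^ (3 * (m + k)) * ((γ * ((L : ℝ)⁻¹) ^ k)⁻¹) ^ A *
      Real.exp (-(c * B10.pFun b₀ p₀ (Real.sqrt (γ * ((L : ℝ)⁻¹) ^ k)) ^ 2)) := ⟨_, rfl⟩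
  rw [← ha] at hsum
  have ha0 : ∀ k, 0 ≤ a k := fun k => by
    rw [ha]; dsimp only; positivity
  -- the refined summand at `(n, i)` IS `a(i + n)`
  have hterm : ∀ n i : ℕ,
      C * (L : ℝ) ^ (3 * (m + n + i)) * ((γ * ((L : ℝ)⁻¹) ^ n * ((L : ℝ)⁻¹) ^ i)⁻¹) ^ A *
          Real.exp (-(c * B10.pFun b₀ p₀ (Real.sqrt (γ * ((L : ℝ)⁻¹) ^ n * ((L : ℝ)⁻¹) ^ i)) ^ 2)) = a (i + n) := by
    intro n i
    have key : γ * ((L : ℝ)⁻¹) ^ n * ((L : ℝ)⁻¹) ^ i = γ * ((L : ℝ)⁻¹) ^ (i + n) := by rw [pow_add]; ring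
    have key2 : m + n + i = m + (i + n) := by omega
    rw [ha, key, key2]
  refine ⟨fun n => ∑' k, a (k + n), tendsto_sum_nat_add a, fun n K => ?_⟩
  have hs : Summable fun k => a (k + n) := (summable_nat_add_iff n).mpr hsum
  calc ∑ i ∈ Finset.range (K + 1), C * (L : ℝ) ^ (3 * (m + n + i)) * ((γ * ((L : ℝ)⁻¹) ^ n * ((L : ℝ)⁻¹) ^ i)⁻¹) ^ A *
          Real.exp (-(c * B10.pFun b₀ p₀ (Real.sqrt (γ * ((L : ℝ)⁻¹) ^ n * ((L : ℝ)⁻¹) ^ i)) ^ 2))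
        = ∑ i ∈ Finset.range (K + 1), a (i + n) := Finset.sum_congr rfl fun i _ => hterm n i
    _ ≤ ∑' k, a (k + n) := hs.sum_le_tsum (Finset.range (K + 1)) fun i _ => ha0 _

end Summit.QuantumFields.YangMills.Theorems.LargeFieldMassRefinementTail

end
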